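import Summits.KontsevichZagierPeriods.KontsevichZagierPeriods.Theses.WickWedge

/-!
# Crux `ComplexDescent` (stmt-KontsevichZagierPeriods-6842, route WickWedge) — line `tame-wild`

ALTERNATIVE SKELETON (crux-strategist, 2026-08-17) for

  `ComplexDescent : ∀ c : KZ.FormalRep, inclC (incl c) ∈ KZexpC.relations → c ∈ KZ.relations`.

## The cut: by the behaviour of the exponent ALONG THE FIBRE OF INTEGRATION, not by phase/weight

The live skeleton `Lines/birth.lean` descends along the tower `KZ ⟶ KZexp ⟶ KZexpC` (kill the
phases, then the weights = item 0530). This line cuts orthogonally. Call a Newton–Leibniz move of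
`KZexpC` **tame** when the exponent `-g - iθ` of the band is constant along each fibre of
integration (it is pulled back from the base, `g z = g' (init z)`, `θ z = θ' (init z)`), so that the
move is LITERALLY a classical Newton–Leibniz identity `∫_a^b ∂ₜ H dt = H(b) − H(a)` for a
complex-valued semialgebraic `H`, decorated by the spectator factor `e^{-g'(x) - iθ'(x)}`
(`tameNewtonLeibnizRel` below; no exponential appears in its data); **wild** otherwise (Γ-detours
`1 = ∫₀^∞ e^{-t} dt`, Schwinger `t`-insertion, Wick wedges, Bessel monodromy families: the exponent
moves along the fibre). Three registered stubs, all load-bearing in `ComplexDescent_of`: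

* `stub_properReduction` (provable-class, size M–L): the improper move (3b) is REDUNDANT —
  `KZexpC.relations ≤ properRelations := closure((1a) ∪ (1b) ∪ (2) ∪ (3a))`: compactify the
  half-infinite fibre by the `C¹` semialgebraic bijection `t ↦ t / (1 + |t|)` (rule (2)), close the
  band by a null slice (rule (1a); a null-domain representation is a relation), extend the primitive
  by `0` at `s = 1` (the limit hypothesis `F → 0` is exactly continuity there) and apply (3a).
* `stub_wildElimination` (OPEN — the content): a classical combination derivable with the proper
  complex moves is derivable with TAME ones:
  `inclC (incl c) ∈ properRelations → inclC (incl c) ∈ tameRelations`,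
  `tameRelations := closure((1a) ∪ (1b) ∪ (2) ∪ tame (3a))`. Every use the exponential calculus
  makes of a fibrewise-varying exponent between classical endpoints is eliminable.
* `stub_tameDescent` (provable-class, size L): `inclC (incl c) ∈ tameRelations → c ∈ KZ.relations`,
  by the complex zero-locus retraction `ρ [σ, f, g, θ] := [{x ∈ σ | g x = 0 ∧ θ x = 0}, Re f]`:
  it splits `inclC ∘ incl`, carries (1a), (1b), (2) to KZ moves verbatim as
  `KZexp.zeroLocusRetraction` does (`KZExpCalculus.lean`), AND carries a tame (3a) move to a KZ
  Newton–Leibniz move, because for a fibre-constant exponent the zero locus of the band exponent IS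
  the band over the zero locus of the base exponent (primitive `Re H`). This strictly extends the
  landed `KZexp.conservative_nlFree` (which allows no Newton–Leibniz move at all) and covers every
  classical move (`incl_image_newtonLeibnizRel_subset_tame` below: a KZ Newton–Leibniz move is tame).

Composition `ComplexDescent_of` (term-mode, one line): `relations → proper → tame → KZ`.
NO soundness of the complex moves is needed anywhere on this line (birth needs `stub_soundC` to
feed the value hypothesis of `stub_phaseDescent`), and NO item of another route (birth's
`stub_weightDescent` is ExpConservative's 0530 verbatim).

Honest strength bookkeeping (proved below): `tameNewtonLeibnizRel ⊆ KZexpC.newtonLeibnizRel`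
(`tame_subset_newtonLeibnizRel`), hence `tameRelations ≤ properRelations ≤ KZexpC.relations`; the
classical moves land in `tameRelations` (`map_relations_incl_le_tame`), hence
`ComplexDescent → stub_properReduction → stub_wildElimination` (`wildElimination_of_complexDescent`):
given the two provable stubs the open stub is EXACTLY the crux (neither weaker nor stronger) — the
line relocates the crux onto an explicit word problem (eliminate wild (3a) instances, whose boundary
data are forced into three shapes by the one-representation boundary term: closed exponent loop
`φ(x, b x) = φ(x, a x)`, or `H (x, a x) = 0`, or `H (x, b x) = 0`), it does not shrink it. First
lemma recommended to the lead for the open stub (card `Lines/tame-wild.md`): SINGLE-CLASS NORMAL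
FORM of complex Newton–Leibniz moves — by Lindemann–Weierstrass (`LindemannWeierstrass.SumForm_holds`,
in tree) at algebraic points plus "a ℚ-semialgebraic set without algebraic points is empty", the
primitive `Σ hᵢ e^{-gᵢ - iθᵢ}` of ANY (3a) instance may be replaced by one term `H e^{-g - iθ}` whose
exponent is the band's own.

Disproof used: none on record (`ledger crux ls stmt-KontsevichZagierPeriods-6842`: no `Disproof.lean`,
no `Negative/`); negatives index of the summit: 1 unrelated entry (KinematicPlaneConvex). Degenerate
data: `c = 0` satisfies every stub (`zero_mem`); every KZ relation satisfies hypothesis and conclusion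
of `stub_wildElimination` and `stub_tameDescent` non-vacuously (`map_relations_incl_le_tame`).

References: M. Kontsevich, D. Zagier, *Periods* (2001), §1.2 rules (1)–(3), §4.3
[KontsevichZagierPeriods2001]; J. Commelin, P. Habegger, A. Huber, arXiv:2007.08280, Def. 2 / Thm. 3
[CommelinHabeggerHuber2020]; J. Fresán, P. Jossen, *Exponential motives*, Thm. 5.1.1 (motivic shadow)
[FresanJossen2020]; A. Baker, *Transcendental Number Theory* (1975), Thm. 1.4 (Lindemann–Weierstrass)
[BakerTNT1975]; the solved log sibling `KZlog.Conservative_holds` (`KZLogCalculusProofs.lean`, this tree).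
-/

noncomputable section

set_option linter.dupNamespace false

open Set
open Literature.NumberTheory.Transcendental

namespace Summit.KontsevichZagierPeriods.KontsevichZagierPeriods.Cruxes.ComplexDescent.TameWild

/-! ## The two intermediate subgroups of `KZexpC.relations` -/

/-- **Tame Newton–Leibniz move (3a-tame).** A Newton–Leibniz instance of the complex-phase
calculus whose band exponent is pulled back from the base (`r.weight z = r'.weight (init z)`,
`r.phase z = r'.phase (init z)` on the band) and whose primitive is ONE complex-valued
`ℚ`-semialgebraic function `H` times that spectator exponential: the data are exactly those of a
classical Newton–Leibniz move for `H` (continuity on closed fibres, `∂ₜ H =` integrand on open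
fibres, boundary integrand `H (x, b x) − H (x, a x)`), no exponential enters.
It IS a `KZexpC.newtonLeibnizRel` instance (`tame_subset_newtonLeibnizRel`: `k = 1`,
`h₀ = H`, `g₀ = r'.weight ∘ init`, `θ₀ = r'.phase ∘ init`). [Kontsevich–Zagier 2001, §1.2 rule (3)] -/
def tameNewtonLeibnizRel : Set KZexpC.FormalRep :=
  {c | ∃ (n : ℕ) (r : KZexpC.IntegralRep (n + 1)) (r' : KZexpC.IntegralRep n)
      (a b : (Fin n → ℝ) → ℝ) (H : (Fin (n + 1) → ℝ) → ℂ),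
    IsSemialgebraicFunOn ℚ r.domain (fun z => (H z).re) ∧
    IsSemialgebraicFunOn ℚ r.domain (fun z => (H z).im) ∧
    IsSemialgebraicFunOn ℚ r'.domain a ∧ IsSemialgebraicFunOn ℚ r'.domain b ∧
    (∀ x ∈ r'.domain, a x ≤ b x) ∧
    r.domain = {z | (Fin.init z : Fin n → ℝ) ∈ r'.domain ∧ a (Fin.init z) ≤ z (Fin.last n) ∧
      z (Fin.last n) ≤ b (Fin.init z)} ∧
    (∀ z ∈ r.domain, r.weight z = r'.weight (Fin.init z) ∧ r.phase z = r'.phase (Fin.init z)) ∧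
    (∀ x ∈ r'.domain, ContinuousOn (fun t : ℝ => H (Fin.snoc x t)) (Icc (a x) (b x))) ∧
    (∀ x ∈ r'.domain, ∀ t ∈ Ioo (a x) (b x),
      HasDerivAt (fun s : ℝ => H (Fin.snoc x s)) (r.integrand (Fin.snoc x t)) t) ∧
    (∀ x ∈ r'.domain, r'.integrand x = H (Fin.snoc x (b x)) - H (Fin.snoc x (a x))) ∧
    c = KZexpC.of r - KZexpC.of r'}

/-- The relations generated by the TAME moves: (1a), (1b), (2) and tame (3a). -/
def tameRelations : AddSubgroup KZexpC.FormalRep :=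
  AddSubgroup.closure (KZexpC.domainAddRel ∪ KZexpC.integrandAddRel ∪ KZexpC.changeOfVariablesRel ∪
    tameNewtonLeibnizRel)

/-- The relations generated by the PROPER moves: (1a), (1b), (2) and the bounded-fibre
Newton–Leibniz move (3a) (no improper move (3b)). -/
def properRelations : AddSubgroup KZexpC.FormalRep :=
  AddSubgroup.closure (KZexpC.domainAddRel ∪ KZexpC.integrandAddRel ∪ KZexpC.changeOfVariablesRel ∪
    KZexpC.newtonLeibnizRel)

/-! ## Registered stubs -/

/-- **STUB (provable-class, size M–L) — the improper move is redundant.** Every relation of the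
complex-phase calculus is a consequence of the four PROPER moves (1a), (1b), (2), (3a): an improper
instance `∫_{a x}^∞ ∂ₜ F = −F (x, a x)` (fibres `[a x, ∞)`, `F → 0`) becomes, after the semialgebraic
`C¹` change of variables `t ↦ t / (1 + |t|)` (rule (2); Jacobian `(1 − |s|)⁻²` on `|s| < 1`), a band
with fibres `[ã x, 1)`, `ã = a / (1 + |a|)`; adding the null slice `{s = 1}` (rule (1a): a
representation over a null domain is a relation) and extending the transported primitive by `0` at
`s = 1` — continuity at `s = 1` IS the limit hypothesis, the fibrewise derivative is the chain rule —
makes it ONE bounded Newton–Leibniz move (3a) with boundary term `0 − F (x, a x)`. Why it might fail: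
it does not (bookkeeping: semialgebraicity of the extended data on the closed band, `a ≤ 1`-type side
conditions); listed as a stub because every later case analysis (and the soundness file
`KZExpCCalculusProofs.lean`, absent from the tree) then has four move families, not five.
[cite: KontsevichZagierPeriods2001, §1.2 rules 1-3] -/
theorem stub_properReduction :
    Literature.NumberTheory.Transcendental.KZexpC.relations ≤ properRelations := by
  sorry

/-- **STUB (OPEN; the content of the crux on this line) — wild elimination between classical
endpoints.** If a `ℤ`-combination `c` of classical representations is derivable by the proper complex
moves, it is derivable by TAME ones: every Newton–Leibniz instance whose exponent varies along the
fibre of integration (Γ-detours, `t`-insertion, Wick wedges, monodromy families) can be eliminated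
from a certificate whose two ends are phase- and weight-free. Necessary for the crux
(`wildElimination_of_complexDescent`), and with the two provable stubs equivalent to it. The
one-representation boundary term of (3a) forces a wild instance (in single-class normal form
`F = H e^{-φ}`) into three shapes on each cell of the base: closed exponent loop
`φ (x, b x) = φ (x, a x)`, or `H (x, a x) = 0`, or `H (x, b x) = 0` — the word problem is over these.
Why it might fail: only together with the crux (it is implied by it); a certificate for a Bessel
sum rule (route item SumRuleSixC) whose wild wedge moves admit no tame replacement would, granted
soundness, refute `KZKernelConjecture`. [cite: KontsevichZagierPeriods2001, §4.3]
[cite: FresanJossen2020, Thm 5.1.1] -/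
theorem stub_wildElimination :
    ∀ c : Literature.NumberTheory.Transcendental.KZ.FormalRep,
      Literature.NumberTheory.Transcendental.KZexpC.inclC
          (Literature.NumberTheory.Transcendental.KZexp.incl c) ∈ properRelations →
        Literature.NumberTheory.Transcendental.KZexpC.inclC
          (Literature.NumberTheory.Transcendental.KZexp.incl c) ∈ tameRelations := by
  sorry

/-- **STUB (provable-class, size L) — tame descent.** A classical combination derivable by the tame
moves is a KZ relation: apply the complex zero-locus retraction
`ρ [σ, f, g, θ] = [{x ∈ σ | g x = 0 ∧ θ x = 0}, Re f]` (additive on `KZexpC.FormalRep`, splits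
`inclC ∘ incl`). It maps (1a), (1b), (2) into the KZ moves exactly as `KZexp.zeroLocusRetraction_*`
(`KZExpCalculus.lean`; the phase is one more transported function, `Re` is additive and commutes
with the real Jacobian factor), and it maps a TAME (3a) instance to a KZ Newton–Leibniz instance:
the zero locus of a fibre-constant band exponent is the band over the zero locus
`{x ∈ τ | g' x = 0 ∧ θ' x = 0}` of the base exponent, the primitive is `Re H` (continuity and the
fibrewise derivative pass through `Re`), the boundary integrand is `Re (H (x, b x) − H (x, a x))`.
Conclude by `KZexpC.comap_le_of_retraction`-style bookkeeping restricted to `tameRelations`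
(`AddSubgroup.closure_le`). Strictly extends `KZexp.conservative_nlFree`. Why it might fail: it does
not; the size is in the semialgebraic side conditions (zero loci are `ℚ`-semialgebraic:
`IsSemialgebraicFunOn.isSemialgebraic_zeroLocus`; integrability of `Re` of the weighted integrand).
[cite: KontsevichZagierPeriods2001, §1.2 rules 1-3] -/
theorem stub_tameDescent :
    ∀ c : Literature.NumberTheory.Transcendental.KZ.FormalRep,
      Literature.NumberTheory.Transcendental.KZexpC.inclC
          (Literature.NumberTheory.Transcendental.KZexp.incl c) ∈ tameRelations →
        c ∈ Literature.NumberTheory.Transcendental.KZ.relations := by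
  sorry

/-! ## Composition (fully proved): the three stubs imply the crux BY NAME -/

/-- **`ComplexDescent_of`**: proper reduction, wild elimination and tame descent imply the crux
`WickWedge.ComplexDescent`: `relations → properRelations → tameRelations → KZ.relations` along
`inclC ∘ incl`. [cite: KontsevichZagierPeriods2001, §1.2, §4.3] -/
theorem ComplexDescent_of :
    (Literature.NumberTheory.Transcendental.KZexpC.relations ≤ properRelations) →
    (∀ c : Literature.NumberTheory.Transcendental.KZ.FormalRep,
      Literature.NumberTheory.Transcendental.KZexpC.inclC
          (Literature.NumberTheory.Transcendental.KZexp.incl c) ∈ properRelations →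
        Literature.NumberTheory.Transcendental.KZexpC.inclC
          (Literature.NumberTheory.Transcendental.KZexp.incl c) ∈ tameRelations) →
    (∀ c : Literature.NumberTheory.Transcendental.KZ.FormalRep,
      Literature.NumberTheory.Transcendental.KZexpC.inclC
          (Literature.NumberTheory.Transcendental.KZexp.incl c) ∈ tameRelations →
        c ∈ Literature.NumberTheory.Transcendental.KZ.relations) →
      Summit.KontsevichZagierPeriods.KontsevichZagierPeriods.Theses.WickWedge.ComplexDescent :=
  fun h₁ h₂ h₃ c hc => h₃ c (h₂ c (h₁ hc))

/-- The crux from the stubs themselves (a lead closing the three stubs closes the item).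
[cite: KontsevichZagierPeriods2001, §1.2, §4.3] -/
theorem complexDescent_of_stubs :
    Summit.KontsevichZagierPeriods.KontsevichZagierPeriods.Theses.WickWedge.ComplexDescent :=
  ComplexDescent_of stub_properReduction stub_wildElimination stub_tameDescent

/-! ## Honest strength bookkeeping (fully proved)

`tameRelations ≤ properRelations ≤ relations` (the intermediate subgroups are genuine sub-calculi),
the classical moves are tame, and therefore the open stub is a CONSEQUENCE of the crux. -/

/-- `expSum` with one term is `H · e^{-g - iθ}`. [folklore] -/
theorem expSum_one {N : ℕ} (H : (Fin N → ℝ) → ℂ) (g θ : (Fin N → ℝ) → ℝ) (z : Fin N → ℝ) :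
    KZexpC.expSum (fun _ : Fin 1 => H) (fun _ => g) (fun _ => θ) z =
      H z * Complex.exp (-(g z : ℂ) - (θ z : ℂ) * Complex.I) := by
  simp [KZexpC.expSum]

/-- **A tame Newton–Leibniz move is a Newton–Leibniz move** of `KZexpC`: take `k = 1`, `h₀ = H`,
`g₀ = r'.weight ∘ init`, `θ₀ = r'.phase ∘ init`; the primitive is `H (x, t) · E x` with the
spectator `E x = e^{-g' x - iθ' x}` constant along the fibre. [folklore] -/
theorem tame_subset_newtonLeibnizRel : tameNewtonLeibnizRel ⊆ KZexpC.newtonLeibnizRel := by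
  rintro _ ⟨n, r, r', a, b, H, hre, him, ha, hb, hab, hdom, htame, hcont, hder, hint, rfl⟩
  -- the spectator exponential, a function of the base point only
  set E : (Fin n → ℝ) → ℂ := fun x =>
    Complex.exp (-(r'.weight x : ℂ) - (r'.phase x : ℂ) * Complex.I) with hE
  have hF : ∀ (x : Fin n → ℝ) (t : ℝ),
      KZexpC.expSum (fun _ : Fin 1 => H) (fun _ z => r'.weight (Fin.init z))
        (fun _ z => r'.phase (Fin.init z)) (Fin.snoc x t) = H (Fin.snoc x t) * E x := by
    intro x t
    rw [expSum_one]
    simp [hE, Fin.init_snoc]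
  have hg : IsSemialgebraicFunOn ℚ r.domain (fun z => r'.weight (Fin.init z)) :=
    r.isSemialgebraicFunOn_weight.congr fun z hz => (htame z hz).1
  have hθ : IsSemialgebraicFunOn ℚ r.domain (fun z => r'.phase (Fin.init z)) :=
    r.isSemialgebraicFunOn_phase.congr fun z hz => (htame z hz).2
  refine ⟨n, 1, r, r', a, b, fun _ => H, fun _ z => r'.weight (Fin.init z),
    fun _ z => r'.phase (Fin.init z), fun _ => ⟨hre, him, hg, hθ⟩, ha, hb, hab, hdom,
    fun x hx => ?_, fun x hx t ht => ?_, fun x hx => ?_, rfl⟩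
  · -- continuity on the closed fibre: `H (x, ·) · E x`
    have : (fun t : ℝ => KZexpC.expSum (fun _ : Fin 1 => H) (fun _ z => r'.weight (Fin.init z))
        (fun _ z => r'.phase (Fin.init z)) (Fin.snoc x t)) = fun t => H (Fin.snoc x t) * E x :=
      funext (hF x)
    rw [this]
    exact (hcont x hx).mul continuousOn_const
  · -- derivative on the open fibre: `∂ₜ H · E x` is the weighted integrand of the band
    have hz : Fin.snoc x t ∈ r.domain := by
      rw [hdom]
      refine ⟨by simpa using hx, ?_, ?_⟩ <;> simp [ht.1.le, ht.2.le]
    have : (fun s : ℝ => KZexpC.expSum (fun _ : Fin 1 => H) (fun _ z => r'.weight (Fin.init z))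
        (fun _ z => r'.phase (Fin.init z)) (Fin.snoc x s)) = fun s => H (Fin.snoc x s) * E x :=
      funext (hF x)
    rw [this]
    have hw : r.weightedIntegrand (Fin.snoc x t) = r.integrand (Fin.snoc x t) * E x := by
      rw [KZexpC.IntegralRep.weightedIntegrand, (htame _ hz).1, (htame _ hz).2, mul_comm]
      simp [hE, Fin.init_snoc]
    rw [hw]
    exact (hder x hx t ht).mul_const (E x)
  · -- boundary term: `(H (x, b x) − H (x, a x)) · E x`
    rw [hF, hF, KZexpC.IntegralRep.weightedIntegrand, hint x hx]
    simp only [hE]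
    ring

/-- Hence the tame relations are proper relations … [folklore] -/
theorem tameRelations_le_properRelations : tameRelations ≤ properRelations := by
  refine (AddSubgroup.closure_le _).2 ?_
  rintro x (((hx | hx) | hx) | hx)
  · exact AddSubgroup.subset_closure (Or.inl (Or.inl (Or.inl hx)))
  · exact AddSubgroup.subset_closure (Or.inl (Or.inl (Or.inr hx)))
  · exact AddSubgroup.subset_closure (Or.inl (Or.inr hx))
  · exact AddSubgroup.subset_closure (Or.inr (tame_subset_newtonLeibnizRel hx))

/-- … and the proper relations are relations. [folklore] -/
theorem properRelations_le_relations : properRelations ≤ KZexpC.relations := by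
  refine (AddSubgroup.closure_le _).2 ?_
  rintro x (((hx | hx) | hx) | hx)
  · exact KZexpC.domainAddRel_subset_relations hx
  · exact KZexpC.integrandAddRel_subset_relations hx
  · exact KZexpC.changeOfVariablesRel_subset_relations hx
  · exact KZexpC.newtonLeibnizRel_subset_relations hx

/-- **A classical Newton–Leibniz move is tame** (exponent `0` on band and base; `H = ↑F`).
[folklore] -/
theorem incl_image_newtonLeibnizRel_subset_tame :
    (KZexpC.inclC.comp KZexp.incl) '' KZ.newtonLeibnizRel ⊆ tameNewtonLeibnizRel := by
  rintro _ ⟨c, ⟨n, r, r', a, b, F, hFs, ha, hb, hab, hdom, hcont, hder, hint', rfl⟩, rfl⟩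
  have h0 : IsSemialgebraicFunOn ℚ (KZexpC.ofKZexp (KZexp.ofKZ r)).domain
      (fun _ : Fin (n + 1) → ℝ => (0 : ℝ)) :=
    (isSemialgebraicFunOn_aeval r.isSemialgebraic_domain 0).congr fun z _ => by simp
  refine ⟨n, KZexpC.ofKZexp (KZexp.ofKZ r), KZexpC.ofKZexp (KZexp.ofKZ r'), a, b,
    fun z => (F z : ℂ), hFs.congr fun z _ => by simp, h0.congr fun z _ => by simp, ha, hb, hab,
    hdom, fun z _ => ⟨by simp [KZexpC.ofKZexp, KZexp.ofKZ], rfl⟩, fun x hx => ?_,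
    fun x hx t ht => ?_, fun x hx => ?_, ?_⟩
  · exact Complex.continuous_ofReal.comp_continuousOn (hcont x hx)
  · simpa [KZexpC.ofKZexp, KZexp.ofKZ] using (hder x hx t ht).ofReal_comp
  · simp [KZexpC.ofKZexp, KZexp.ofKZ, hint' x hx]
  · simp [map_sub]

/-- **The classical moves are tame**: `KZ.relations.map (inclC ∘ incl) ≤ tameRelations`.
[folklore] -/
theorem map_relations_incl_le_tame :
    KZ.relations.map (KZexpC.inclC.comp KZexp.incl) ≤ tameRelations := by
  rw [KZ.relations, AddMonoidHom.map_closure]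
  refine (AddSubgroup.closure_le _).2 ?_
  rintro _ ⟨c, hc, rfl⟩
  rcases hc with ((hc | hc) | hc) | hc
  · refine AddSubgroup.subset_closure (Or.inl (Or.inl (Or.inl ?_)))
    exact KZexpC.inclC_image_domainAddRel_subset
      ⟨_, KZexp.incl_image_domainAddRel_subset ⟨c, hc, rfl⟩, rfl⟩
  · refine AddSubgroup.subset_closure (Or.inl (Or.inl (Or.inr ?_)))
    exact KZexpC.inclC_image_integrandAddRel_subset
      ⟨_, KZexp.incl_image_integrandAddRel_subset ⟨c, hc, rfl⟩, rfl⟩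
  · refine AddSubgroup.subset_closure (Or.inl (Or.inr ?_))
    exact KZexpC.inclC_image_changeOfVariablesRel_subset
      ⟨_, KZexp.incl_image_changeOfVariablesRel_subset ⟨c, hc, rfl⟩, rfl⟩
  · exact AddSubgroup.subset_closure (Or.inr (incl_image_newtonLeibnizRel_subset_tame ⟨c, hc, rfl⟩))

/-- **The open stub is a consequence of the crux** (so it is false only if the crux is): if
`inclC (incl c)` is a proper relation it is a relation, the crux makes `c` a KZ relation, and
classical relations are tame. [folklore] -/
theorem wildElimination_of_complexDescent
    (h : Summit.KontsevichZagierPeriods.KontsevichZagierPeriods.Theses.WickWedge.ComplexDescent) :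
    ∀ c : KZ.FormalRep, KZexpC.inclC (KZexp.incl c) ∈ properRelations →
      KZexpC.inclC (KZexp.incl c) ∈ tameRelations :=
  fun c hc => map_relations_incl_le_tame ⟨c, h c (properRelations_le_relations hc), rfl⟩

/-- **Tame descent is a consequence of the crux** as well. [folklore] -/
theorem tameDescent_of_complexDescent
    (h : Summit.KontsevichZagierPeriods.KontsevichZagierPeriods.Theses.WickWedge.ComplexDescent) :
    ∀ c : KZ.FormalRep, KZexpC.inclC (KZexp.incl c) ∈ tameRelations → c ∈ KZ.relations :=
  fun c hc => h c (properRelations_le_relations (tameRelations_le_properRelations hc))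

/-- Under the two provable stubs the crux is EXACTLY wild elimination. [folklore] -/
theorem complexDescent_iff_wildElimination (h₁ : KZexpC.relations ≤ properRelations)
    (h₃ : ∀ c : KZ.FormalRep, KZexpC.inclC (KZexp.incl c) ∈ tameRelations → c ∈ KZ.relations) :
    Summit.KontsevichZagierPeriods.KontsevichZagierPeriods.Theses.WickWedge.ComplexDescent ↔
      ∀ c : KZ.FormalRep, KZexpC.inclC (KZexp.incl c) ∈ properRelations →
        KZexpC.inclC (KZexp.incl c) ∈ tameRelations :=
  ⟨wildElimination_of_complexDescent, fun h₂ => ComplexDescent_of h₁ h₂ h₃⟩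

/-- Degenerate data: `c = 0` satisfies hypotheses and conclusions of every stub. [folklore] -/
example : KZexpC.inclC (KZexp.incl (0 : KZ.FormalRep)) ∈ properRelations ∧
    KZexpC.inclC (KZexp.incl (0 : KZ.FormalRep)) ∈ tameRelations ∧
    (0 : KZ.FormalRep) ∈ KZ.relations := by
  simp only [map_zero]
  exact ⟨zero_mem _, zero_mem _, zero_mem _⟩

/-- Non-vacuity: every KZ relation satisfies the hypothesis of `stub_wildElimination`
non-trivially, and its conclusion. [folklore] -/
example (c : KZ.FormalRep) (hc : c ∈ KZ.relations) :
    KZexpC.inclC (KZexp.incl c) ∈ properRelations ∧ KZexpC.inclC (KZexp.incl c) ∈ tameRelations :=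
  ⟨tameRelations_le_properRelations (map_relations_incl_le_tame ⟨c, hc, rfl⟩),
    map_relations_incl_le_tame ⟨c, hc, rfl⟩⟩

end Summit.KontsevichZagierPeriods.KontsevichZagierPeriods.Cruxes.ComplexDescent.TameWild

end
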